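import Literature.Barriers.AtomisticToContinuum.TetrahedralFrustrationProofs
import Mathlib.Geometry.Euclidean.PerpBisector
import Mathlib.Topology.Algebra.Order.LiminfLimsup
import Mathlib.MeasureTheory.Integral.IntervalIntegral.Basic
import Mathlib.Analysis.SpecialFunctions.Integrals.Basic
import Mathlib.LinearAlgebra.Matrix.Determinant.Basic
import HarnessLib

/-!
# Rogers's simplex bound `σ₃` (the named fact `Rogers1958_bound`) — the reduction, proved

Topic `Literature/Barriers/AtomisticToContinuum`; provefact programme for the named fact
`Literature.Barriers.AtomisticToContinuum.Rogers1958_bound` of `TetrahedralFrustration.lean`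
(sibling, imported): for every packing `V` of unit balls in `ℝ³`,
`limsup_{r → ∞} δ(V, 0, r) ≤ σ₃ = √2 (3 arccos(1/3) − π) ≈ 0.7797` (`rogersBound`), with
`δ = finiteDensity`, `Ω = voronoiCell`, `IsSaturated` as defined there.

Hales's blueprint book only QUOTES the bound (§6.2, p. 150); the printed proof followed here is
C. A. Rogers, *Packing and Covering* (1964), Chapter 7 "Packings of spheres cannot be very dense",
Theorem 7.1 `δ(K) ≤ σₙ` (for `n = 3`: Introduction §3, "`δ(K₃) ≤ √18 (cos⁻¹ ⅓ − π/3) = 0.7797…`"),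
the book form of Rogers's 1958 paper.  Rogers's proof: (§1) the Voronoi polyhedra of a packing
with covering radius `R` are bounded polyhedra; (§2) each is dissected into simplices
`c₀ c₁ … cₙ`, `c₀ =` the centre, `cⱼ =` the point nearest to the centre of an `(n − j)`-face
containing `c_{j+1}, …, cₙ`; (§3) Lemma 1 (Blichfeldt): the `(n − i)`-plane of an `(n − i)`-face
is at distance `≥ √(2i/(i+1))` from the centre; Lemma 2: `cᵢ · cⱼ ≥ 2i/(i+1)` for
`1 ≤ i ≤ j ≤ n` (origin `c₀`); (§4) the linear map `L : cᵢ ↦ gᵢ` onto the canonical orthoscheme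
`G` (`gᵢ · gⱼ = 2i/(i+1)`) does not increase norms on the simplex, so
`μ(K ∩ T)/μ(T) ≤ μ(S ∩ G)/μ(G) = σₙ` for every simplex `T` of the dissection; summing over the
dissection bounds the density.

## What this file PROVES (sorry-free) and what it leaves as NAMED FACTS

The theory is too large for one file (triage XL); this file fixes the architecture, proves the
whole reduction, and isolates two inputs as named facts to be discharged in sibling files:

* Part 0 (proved): packing/Voronoi API beyond `TetrahedralFrustrationProofs.lean` (imported:
  cells closed/convex/measurable, `B̄(v,1) ⊆ Ω(V,v)`, `Ω(V,v) ⊆ B(v,2)` for saturated `V`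
  [HalesDSP2012, Lemma 6.7], saturated extension by Zorn): two cells meet inside the
  perpendicular bisector, a null set; finitely many centres in a ball [HalesDSP2012, Lemma 6.2];
  `δ` is monotone in `V`.
* Part 1 (proved): simplices `rogersSimplex v c = {v + t₁c₁ + t₂c₂ + t₃c₃ : t ∈ Δ₃}` as linear
  images of the parameter simplex `Δ₃`; compactness, measurability, translation invariance,
  `vol = |det L_c| · vol Δ₃`.
* Part 2 (proved): **Rogers's monotonicity lemma** `volume_ball_inter_mul_le_of_gram_le`: if
  `Gram(c) ≥ Gram(d)` entrywise then `vol(B ∩ T_c) · vol(T_d) ≤ vol(B ∩ T_d) · vol(T_c)`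
  [Rogers1964, Ch. 7 §4].
* Part 3 (proved): Rogers's Gram conditions `IsRogersGram` (`cᵢ · cⱼ ≥ 2i/(i+1)`, Lemma 2) and
  the canonical orthoscheme `g` with `gᵢ · gⱼ = 2 min(i,j)/(min(i,j)+1)` [Rogers1964, Ch. 7 §4].
* Part 4: PROVED `volume_rogersOrthoscheme` (`vol T_g = |det L_g| · vol Δ₃ = √2/36`, with
  `vol Δₙ(s) = sⁿ/n!` from Part 1a); NAMED FACT `Rogers1964_orthoschemeSectorVolume`
  (`vol(B(0,1) ∩ T_g) = (3θ − π)/18`, `θ = arccos ⅓`: the solid angle `3θ − π` of the regular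
  tetrahedron by Girard's formula, over `6 · 3`); proved from it and Part 2: the simplex bound
  `vol(B(v,1) ∩ T) ≤ σ₃ vol(T)` for every simplex with Rogers's Gram conditions
  (`volume_ball_inter_le_of_isRogersGram`), using `σ₃ = √2 (3θ − π)` (`rogersBound_eq`).
* Part 5: NAMED FACT `Rogers1964_dissection` (the cell is a.e. a finite a.e.-disjoint union of
  such simplices [Rogers1964, Ch. 7 §§2–3; HalesDSP2012, Lemmas 6.26, 6.29]) and NAMED FACT
  `Rogers1964_cellBound` (`vol B(v,1) ≤ σ₃ vol Ω(V,v)` for saturated `V`); proved: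
  `cellBound_of_dissection` (dissection + constants ⇒ cell bound).
* Part 6 (proved): `finiteDensity_le_of_cellBound` (`δ(V,0,r) ≤ σ₃ (1 + 3/r)³` for saturated `V`,
  the boundary-layer argument of [HalesDSP2012, Lemma 6.13]), `Rogers1958_bound_of_cellBound`
  and `Rogers1958_bound_of_parts : dissection → orthoschemeSectorVolume → Rogers1958_bound`.
* Part 1a (proved, used in Part 4): `volume_cornerSimplex`, `vol {x ∈ ℝⁿ : x ≥ 0, Σ xᵢ ≤ s} =
  sⁿ/n!` by Fubini (`measurePreserving_piFinSuccAbove`) and induction.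

So `Rogers1958_bound` is reduced to two classical, separately checkable inputs; the final
`Rogers1958_bound_holds` lands when they are discharged (sibling files, this programme).

## References

* C. A. Rogers, *Packing and Covering*, Cambridge Tracts in Mathematics and Mathematical Physics
  54, CUP 1964 (`Rogers1964`): Introduction §3 (inequality (19) and the display after it);
  Chapter 7, §1 (pp. 74–77), §2 (pp. 77–78), §3 Lemmas 1–2 (pp. 78–80), §4 Theorem 7.1
  (pp. 80–85).
* C. A. Rogers, *The packing of equal spheres*, Proc. London Math. Soc. (3) 8 (1958) 609–620
  (`Rogers1958`).
* T. C. Hales, *Dense Sphere Packings: a blueprint for formal proofs*, CUP 2012 (`HalesDSP2012`):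
  Definitions 6.1, 6.3, Lemmas 6.2, 6.4, 6.7, 6.8, 6.13, Remark 6.16, §6.2 (p. 150), Definitions
  6.24–6.25, Lemmas 6.26, 6.29.

## Wording risks

* `Rogers1964_dissection` is stated up to null sets (a.e. cover, a.e. disjoint), which is all the
  volume argument uses and is implied by the printed "fit together, without overlapping … and
  without gaps"; the simplices are indexed by their edge vectors `c = (c₁ − c₀, c₂ − c₀, c₃ − c₀)`.
* The sector constant is stated for the concrete orthoscheme `g₁ = (1,0,0)`, `g₂ = (1,1/√3,0)`,
  `g₃ = (1,1/√3,1/√6)`; any simplex with the same Gram matrix is congruent to it.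
* Nothing here uses the unproved facts: every `theorem` is unconditional or takes the named facts
  as explicit hypotheses.
-/

noncomputable section

open Real MeasureTheory Metric Filter Set
open scoped ENNReal RealInnerProductSpace Topology

namespace Literature.Barriers.AtomisticToContinuum

open Literature.Geometry.DiscreteGeometry (IsUnitBallPacking)

/-- Euclidean `3`-space. -/
local notation "E3" => EuclideanSpace ℝ (Fin 3)

variable {V : Set E3}

/-! ### Part 0. Packings, Voronoi cells, saturation

Closedness, convexity, measurability of `Ω(V, v)`, `B̄(v,1) ⊆ Ω(V,v)`, `Ω(V,v) ⊆ B(v,2)` for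
saturated `V` and the saturated extension are in `TetrahedralFrustrationProofs.lean` (imported). -/

/-- In a packing of unit balls the open unit ball about a centre lies in its Voronoi cell.
[folklore] -/
theorem ball_subset_voronoiCell (hV : IsUnitBallPacking V) {v : E3} (hv : v ∈ V) :
    ball v 1 ⊆ voronoiCell V v :=
  ball_subset_closedBall.trans (closedBall_subset_voronoiCell hV hv)

/-- Two Voronoi cells meet only inside the perpendicular bisector of their centres.
[cite: HalesDSP2012, §6.2.1 (display after Definition 6.17: `Ω(V,v) ∩ Ω(V,u) = … ∩ A(u,v)`)] -/
theorem voronoiCell_inter_subset_perpBisector {v w : E3} (hv : v ∈ V) (hw : w ∈ V) :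
    voronoiCell V v ∩ voronoiCell V w ⊆ (AffineSubspace.perpBisector v w : Set E3) := by
  rintro p ⟨hpv, hpw⟩
  rw [SetLike.mem_coe, AffineSubspace.mem_perpBisector_iff_dist_eq]
  exact le_antisymm (hpv w hw) (hpw v hv)

/-- Distinct Voronoi cells of a packing have null intersection (a plane is a null set).
[cite: HalesDSP2012, Lemma 6.4 and §6.2.1] -/
theorem volume_voronoiCell_inter {v w : E3} (hv : v ∈ V) (hw : w ∈ V) (hvw : v ≠ w) :
    volume (voronoiCell V v ∩ voronoiCell V w) = 0 :=
  measure_mono_null (voronoiCell_inter_subset_perpBisector hv hw)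
    (Measure.addHaar_affineSubspace volume _
      fun h => hvw (AffineSubspace.perpBisector_eq_top.1 h))

/-- A packing has only finitely many centres in any ball (cover the ball by finitely many balls
of radius `1`, each of which contains at most one centre). [cite: HalesDSP2012, Lemma 6.2] -/
theorem finite_inter_ball_of_packing (hV : IsUnitBallPacking V) (x : E3) (R : ℝ) :
    (V ∩ ball x R).Finite := by
  obtain ⟨t, ht, hcover⟩ :=
    Metric.totallyBounded_iff.1 (isCompact_closedBall x R).totallyBounded 1 one_pos
  have hsub : V ∩ ball x R ⊆ ⋃ y ∈ t, (V ∩ ball y 1) := by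
    rintro p ⟨hpV, hpR⟩
    obtain ⟨y, hy, hpy⟩ := Set.mem_iUnion₂.1 (hcover (ball_subset_closedBall hpR))
    exact Set.mem_iUnion₂.2 ⟨y, hy, hpV, hpy⟩
  refine (ht.biUnion fun y _ => Set.Subsingleton.finite ?_).subset hsub
  rintro p ⟨hpV, hpy⟩ q ⟨hqV, hqy⟩
  apply hV hpV hqV
  rw [mem_ball] at hpy hqy
  calc dist p q ≤ dist p y + dist q y := dist_triangle_right p q y
    _ < 1 + 1 := add_lt_add hpy hqy
    _ = 2 := by norm_num

/-- The finite density is monotone in the packing. [folklore] -/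
theorem finiteDensity_mono {V W : Set E3} (h : V ⊆ W) (p : E3) (r : ℝ) :
    finiteDensity V p r ≤ finiteDensity W p r := by
  unfold finiteDensity
  gcongr volume (ball p r ∩ ?_) / _
  exact Set.biUnion_subset_biUnion_left h

/-! ### Part 1a. The volume of a corner simplex `{x ≥ 0, Σ xᵢ ≤ s} ⊂ ℝⁿ` is `sⁿ/n!` -/

/-- The corner simplex `Δₙ(s) = {x ∈ ℝⁿ : xᵢ ≥ 0, Σ xᵢ ≤ s}`. [folklore] -/
def cornerSimplex (n : ℕ) (s : ℝ) : Set (Fin n → ℝ) := {x | (∀ i, 0 ≤ x i) ∧ ∑ i, x i ≤ s}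

/-- `Δₙ(s)` is measurable. [folklore] -/
theorem measurableSet_cornerSimplex (n : ℕ) (s : ℝ) : MeasurableSet (cornerSimplex n s) := by
  have h1 : MeasurableSet {x : Fin n → ℝ | ∀ i, 0 ≤ x i} := by
    rw [setOf_forall]
    exact MeasurableSet.iInter fun i => measurableSet_le measurable_const (measurable_pi_apply i)
  exact h1.inter (measurableSet_le (Finset.measurable_sum _ fun i _ => measurable_pi_apply i)
    measurable_const)

/-- `Δₙ(s) = ∅` for `s < 0`. [folklore] -/
theorem cornerSimplex_eq_empty {n : ℕ} {s : ℝ} (hs : s < 0) : cornerSimplex n s = ∅ := by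
  ext x
  simp only [cornerSimplex, mem_setOf_eq, mem_empty_iff_false, iff_false, not_and, not_le]
  intro h
  exact hs.trans_le (Finset.sum_nonneg fun i _ => h i)

/-- `Δₙ₊₁(s)` read in `ℝ × ℝⁿ` (first coordinate split off). [folklore] -/
def cornerSimplexProd (n : ℕ) (s : ℝ) : Set (ℝ × (Fin n → ℝ)) :=
  {p | 0 ≤ p.1 ∧ (∀ i, 0 ≤ p.2 i) ∧ p.1 + ∑ i, p.2 i ≤ s}

/-- The lifted set is measurable. [folklore] -/
theorem measurableSet_cornerSimplexProd (n : ℕ) (s : ℝ) :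
    MeasurableSet (cornerSimplexProd n s) := by
  have h2 : MeasurableSet {p : ℝ × (Fin n → ℝ) | ∀ i, 0 ≤ p.2 i} := by
    have : {p : ℝ × (Fin n → ℝ) | ∀ i, 0 ≤ p.2 i} = ⋂ i, {p | 0 ≤ p.2 i} := by
      ext p; simp
    rw [this]
    exact MeasurableSet.iInter fun i =>
      measurableSet_le measurable_const ((measurable_pi_apply i).comp measurable_snd)
  have h3 : MeasurableSet {p : ℝ × (Fin n → ℝ) | p.1 + ∑ i, p.2 i ≤ s} :=
    measurableSet_le (measurable_fst.add
      (Finset.measurable_sum _ fun i _ => (measurable_pi_apply i).comp measurable_snd))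
      measurable_const
  have h1 : MeasurableSet {p : ℝ × (Fin n → ℝ) | 0 ≤ p.1} :=
    measurableSet_le measurable_const measurable_fst
  have : cornerSimplexProd n s = {p : ℝ × (Fin n → ℝ) | 0 ≤ p.1} ∩
      ({p | ∀ i, 0 ≤ p.2 i} ∩ {p | p.1 + ∑ i, p.2 i ≤ s}) := by
    ext p; simp [cornerSimplexProd]
  rw [this]
  exact h1.inter (h2.inter h3)

/-- Splitting off the first coordinate identifies `Δₙ₊₁(s)` with the lifted set. [folklore] -/
theorem preimage_cornerSimplexProd (n : ℕ) (s : ℝ) :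
    (MeasurableEquiv.piFinSuccAbove (fun _ : Fin (n + 1) => ℝ) 0) ⁻¹' cornerSimplexProd n s =
      cornerSimplex (n + 1) s := by
  ext x
  simp only [MeasurableEquiv.piFinSuccAbove_apply, Fin.insertNthEquiv, mem_preimage,
    cornerSimplexProd, cornerSimplex, mem_setOf_eq, Fin.sum_univ_succ, Fin.forall_fin_succ]
  simp [and_assoc, Fin.tail]

/-- The slices of the lifted set are scaled corner simplices `Δₙ(s − a)`. [folklore] -/
theorem slice_cornerSimplexProd (n : ℕ) (s a : ℝ) :
    Prod.mk a ⁻¹' cornerSimplexProd n s = if 0 ≤ a then cornerSimplex n (s - a) else ∅ := by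
  ext y
  split_ifs with ha
  · simp only [cornerSimplexProd, mem_preimage, mem_setOf_eq, cornerSimplex, ha, true_and]
    constructor <;> rintro ⟨h1, h2⟩ <;> exact ⟨h1, by linarith⟩
  · simp only [cornerSimplexProd, mem_preimage, mem_setOf_eq, mem_empty_iff_false, iff_false,
      not_and]
    exact fun h => absurd h ha

/-- **`vol Δₙ(s) = sⁿ/n!`** (Fubini and induction on `n`). [folklore] -/
theorem volume_cornerSimplex (n : ℕ) {s : ℝ} (hs : 0 ≤ s) :
    volume (cornerSimplex n s) = ENNReal.ofReal (s ^ n / n.factorial) := by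
  induction n generalizing s with
  | zero =>
    have : cornerSimplex 0 s = univ := by
      ext x; simp [cornerSimplex, hs]
    rw [this, volume_pi, Measure.pi_empty_univ]
    simp
  | succ n ih =>
    have e := measurePreserving_piFinSuccAbove (fun _ : Fin (n + 1) => (volume : Measure ℝ)) 0
    rw [← preimage_cornerSimplexProd]
    rw [show (volume : Measure (Fin (n + 1) → ℝ)) = Measure.pi fun _ => volume from rfl,
      e.measure_preimage (measurableSet_cornerSimplexProd n s).nullMeasurableSet,
      show (Measure.pi fun _ : Fin n => (volume : Measure ℝ)) = volume from rfl,
      Measure.prod_apply (measurableSet_cornerSimplexProd n s)]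
    simp_rw [slice_cornerSimplexProd]
    have hslice : ∀ a, volume (if 0 ≤ a then cornerSimplex n (s - a) else ∅) =
        (Icc 0 s).indicator (fun a => ENNReal.ofReal ((s - a) ^ n / n.factorial)) a := by
      intro a
      by_cases ha : 0 ≤ a
      · by_cases has : a ≤ s
        · rw [if_pos ha, indicator_of_mem (mem_Icc.2 ⟨ha, has⟩), ih (by linarith)]
        · rw [if_pos ha, indicator_of_notMem (fun h => has (mem_Icc.1 h).2),
            cornerSimplex_eq_empty (by linarith), measure_empty]
      · rw [if_neg ha, indicator_of_notMem (fun h => ha (mem_Icc.1 h).1), measure_empty]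
    simp_rw [hslice]
    rw [lintegral_indicator measurableSet_Icc,
      ← ofReal_integral_eq_lintegral_ofReal]
    · rw [integral_Icc_eq_integral_Ioc, ← intervalIntegral.integral_of_le hs]
      congr 1
      rw [intervalIntegral.integral_div, intervalIntegral.integral_comp_sub_left (fun x => x ^ n) s,
        sub_self, sub_zero, integral_pow]
      rw [Nat.factorial_succ]
      push_cast
      field_simp
      ring
    · exact (Continuous.integrableOn_Icc (by fun_prop))
    · rw [Filter.EventuallyLE, ae_restrict_iff' measurableSet_Icc]
      exact ae_of_all _ fun a ha => by
        have : 0 ≤ s - a := by linarith [ha.2]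
        positivity

/-! ### Part 1. Simplices spanned by three edge vectors -/

/-- The closed standard parameter simplex `Δ₃ = {t : 0 ≤ tᵢ, t₁ + t₂ + t₃ ≤ 1}` (in `E3`
coordinates). [folklore] -/
def paramSimplex : Set E3 := {t | (∀ i, 0 ≤ t i) ∧ ∑ i, t i ≤ 1}

/-- The linear map `t ↦ t₁ c₁ + t₂ c₂ + t₃ c₃` of `E3` sending the standard basis to the edge
vectors `c`. [folklore] -/
def edgeMap (c : Fin 3 → E3) : E3 →ₗ[ℝ] E3 :=
  ∑ i : Fin 3, (EuclideanSpace.proj i : E3 →L[ℝ] ℝ).toLinearMap.smulRight (c i)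

/-- `L_c t = t₁ c₁ + t₂ c₂ + t₃ c₃`. [folklore] -/
theorem edgeMap_apply (c : Fin 3 → E3) (t : E3) : edgeMap c t = ∑ i, t i • c i := by
  simp [edgeMap, LinearMap.sum_apply]

/-- The (closed, possibly degenerate) simplex with apex `v` and edge vectors `c₁, c₂, c₃`:
`{v + t₁ c₁ + t₂ c₂ + t₃ c₃ : t ∈ Δ₃} = conv{v, v + c₁, v + c₂, v + c₃}`; Rogers's simplices
`c₀ c₁ c₂ c₃` are `rogersSimplex c₀ (cᵢ − c₀)`. [cite: Rogers1964, Ch. 7 §2] -/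
def rogersSimplex (v : E3) (c : Fin 3 → E3) : Set E3 := (fun t => v + edgeMap c t) '' paramSimplex

/-- With apex `0` the simplex is the linear image `L_c(Δ₃)`. [folklore] -/
theorem rogersSimplex_zero (c : Fin 3 → E3) : rogersSimplex 0 c = edgeMap c '' paramSimplex := by
  simp [rogersSimplex]

/-- The simplex with apex `v` is the translate by `v` of the one with apex `0`. [folklore] -/
theorem rogersSimplex_eq_image (v : E3) (c : Fin 3 → E3) :
    rogersSimplex v c = (fun x => v + x) '' rogersSimplex 0 c := by
  rw [rogersSimplex_zero, Set.image_image]; rfl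

/-- The parameter simplex is closed. [folklore] -/
theorem isClosed_paramSimplex : IsClosed paramSimplex := by
  have h1 : IsClosed {t : E3 | ∀ i, 0 ≤ t i} := by
    rw [Set.setOf_forall]
    exact isClosed_iInter fun i => isClosed_le continuous_const (EuclideanSpace.proj i).continuous
  exact h1.inter (isClosed_le (continuous_finsetSum _ fun i _ => (EuclideanSpace.proj i).continuous)
    continuous_const)

/-- The parameter simplex is bounded (it lies in the closed ball of radius `3`). [folklore] -/
theorem paramSimplex_subset_closedBall : paramSimplex ⊆ closedBall (0 : E3) 3 := by
  rintro t ⟨h0, h1⟩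
  rw [mem_closedBall, dist_zero_right, EuclideanSpace.norm_eq]
  have hle : ∀ i, t i ≤ 1 := fun i =>
    le_trans (Finset.single_le_sum (fun j _ => h0 j) (Finset.mem_univ i)) h1
  have hsq : ∀ i, ‖t i‖ ^ 2 ≤ 1 := fun i => by
    rw [Real.norm_eq_abs, sq_abs]; nlinarith [h0 i, hle i]
  calc √(∑ i, ‖t i‖ ^ 2) ≤ √3 := Real.sqrt_le_sqrt (by
        calc ∑ i, ‖t i‖ ^ 2 ≤ ∑ _i : Fin 3, (1 : ℝ) := Finset.sum_le_sum fun i _ => hsq i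
          _ = 3 := by simp)
    _ ≤ 3 := by
        rw [show (3 : ℝ) = √(3 ^ 2) by rw [Real.sqrt_sq (by norm_num)]]
        exact Real.sqrt_le_sqrt (by norm_num)

/-- The parameter simplex is compact. [folklore] -/
theorem isCompact_paramSimplex : IsCompact paramSimplex :=
  (isCompact_closedBall (0 : E3) 3).of_isClosed_subset isClosed_paramSimplex
    paramSimplex_subset_closedBall

/-- Rogers simplices are compact. [folklore] -/
theorem isCompact_rogersSimplex (v : E3) (c : Fin 3 → E3) : IsCompact (rogersSimplex v c) :=
  isCompact_paramSimplex.image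
    (continuous_const.add (edgeMap c).continuous_of_finiteDimensional)

/-- Rogers simplices are measurable. [folklore] -/
theorem measurableSet_rogersSimplex (v : E3) (c : Fin 3 → E3) :
    MeasurableSet (rogersSimplex v c) :=
  (isCompact_rogersSimplex v c).isClosed.measurableSet

/-- Rogers simplices have finite volume. [folklore] -/
theorem volume_rogersSimplex_lt_top (v : E3) (c : Fin 3 → E3) : volume (rogersSimplex v c) < ⊤ :=
  (isCompact_rogersSimplex v c).measure_lt_top

/-- Volume is translation invariant on Rogers simplices. [folklore] -/
theorem volume_rogersSimplex (v : E3) (c : Fin 3 → E3) :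
    volume (rogersSimplex v c) = volume (rogersSimplex 0 c) := by
  rw [rogersSimplex_eq_image v, Set.image_add_left, measure_preimage_add]

/-- `B(v,1) ∩ (v + T) = v + (B(0,1) ∩ T)`. [folklore] -/
theorem ball_inter_rogersSimplex (v : E3) (c : Fin 3 → E3) :
    ball v 1 ∩ rogersSimplex v c = (fun x => v + x) '' (ball 0 1 ∩ rogersSimplex 0 c) := by
  rw [Set.image_inter (add_right_injective v), ← rogersSimplex_eq_image, ← Set.singleton_add,
    singleton_add_ball, add_zero]

/-- `vol(B(v,1) ∩ (v + T)) = vol(B(0,1) ∩ T)`. [folklore] -/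
theorem volume_ball_inter_rogersSimplex (v : E3) (c : Fin 3 → E3) :
    volume (ball v 1 ∩ rogersSimplex v c) = volume (ball 0 1 ∩ rogersSimplex 0 c) := by
  rw [ball_inter_rogersSimplex, Set.image_add_left, measure_preimage_add]

/-- `vol(v + L_c(Δ₃)) = |det L_c| · vol(Δ₃)`. [folklore] -/
theorem volume_rogersSimplex_eq_det (v : E3) (c : Fin 3 → E3) :
    volume (rogersSimplex v c) =
      ENNReal.ofReal |LinearMap.det (edgeMap c)| * volume paramSimplex := by
  rw [volume_rogersSimplex, rogersSimplex_zero, Measure.addHaar_image_linearMap]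

/-! ### Part 2. Rogers's monotonicity lemma -/

/-- `‖t₁ c₁ + t₂ c₂ + t₃ c₃‖² = Σᵢⱼ tᵢ tⱼ ⟪cᵢ, cⱼ⟫`. [folklore] -/
theorem norm_edgeMap_sq (c : Fin 3 → E3) (t : E3) :
    ‖edgeMap c t‖ ^ 2 = ∑ i, ∑ j, t i * t j * ⟪c i, c j⟫ := by
  rw [← real_inner_self_eq_norm_sq, edgeMap_apply, sum_inner]
  refine Finset.sum_congr rfl fun i _ => ?_
  rw [inner_sum]
  refine Finset.sum_congr rfl fun j _ => ?_
  rw [real_inner_smul_left, real_inner_smul_right]; ring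

/-- **Rogers's key inequality.** If the Gram matrix of `c` dominates that of `d` entrywise, then
`‖L_d t‖ ≤ ‖L_c t‖` for every `t` with non-negative coordinates ("the corresponding point `y`
of `E ∩ G` satisfies `(y − g₀)·(y − g₀) ≤ x·x ≤ 1`"). [cite: Rogers1964, Ch. 7 §4 (proof of
Theorem 7.1)] -/
theorem norm_edgeMap_le {c d : Fin 3 → E3} (h : ∀ i j, ⟪d i, d j⟫ ≤ ⟪c i, c j⟫) {t : E3}
    (ht : ∀ i, 0 ≤ t i) : ‖edgeMap d t‖ ≤ ‖edgeMap c t‖ := by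
  have h2 : ‖edgeMap d t‖ ^ 2 ≤ ‖edgeMap c t‖ ^ 2 := by
    rw [norm_edgeMap_sq, norm_edgeMap_sq]
    exact Finset.sum_le_sum fun i _ => Finset.sum_le_sum fun j _ =>
      mul_le_mul_of_nonneg_left (h i j) (mul_nonneg (ht i) (ht j))
  exact (pow_le_pow_iff_left₀ (norm_nonneg _) (norm_nonneg _) two_ne_zero).1 h2

/-- **Rogers's monotonicity lemma (volume form).** If the Gram matrix of the edge vectors `c`
dominates that of `d` entrywise, the fraction of the simplex `T_c = L_c(Δ₃)` covered by the unit
ball at its apex is at most that of `T_d`, in cross-multiplied form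
`vol(B ∩ T_c) · vol(T_d) ≤ vol(B ∩ T_d) · vol(T_c)` (Rogers: the linear map `L = L_d ∘ L_c⁻¹`
"preserves the ratio of two volumes" and maps `K ∩ T` into `S ∩ G`). Degenerate simplices are
allowed (both sides vanish). [cite: Rogers1964, Ch. 7 §4 (proof of Theorem 7.1)] -/
theorem volume_ball_inter_mul_le_of_gram_le {c d : Fin 3 → E3} (h : ∀ i j, ⟪d i, d j⟫ ≤ ⟪c i, c j⟫) :
    volume (ball (0 : E3) 1 ∩ rogersSimplex 0 c) * volume (rogersSimplex 0 d) ≤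
      volume (ball (0 : E3) 1 ∩ rogersSimplex 0 d) * volume (rogersSimplex 0 c) := by
  set P : Set E3 := edgeMap d ⁻¹' ball 0 1 ∩ paramSimplex with hP
  have h1 : ball (0 : E3) 1 ∩ rogersSimplex 0 c ⊆ edgeMap c '' P := by
    rintro x ⟨hx, hx'⟩
    rw [rogersSimplex_zero] at hx'
    obtain ⟨t, ht, rfl⟩ := hx'
    refine ⟨t, ⟨?_, ht⟩, rfl⟩
    rw [Set.mem_preimage, mem_ball_zero_iff]
    rw [mem_ball_zero_iff] at hx
    exact lt_of_le_of_lt (norm_edgeMap_le h ht.1) hx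
  have h2 : ball (0 : E3) 1 ∩ rogersSimplex 0 d = edgeMap d '' P := by
    rw [rogersSimplex_zero, hP, Set.image_preimage_inter]
  calc volume (ball (0 : E3) 1 ∩ rogersSimplex 0 c) * volume (rogersSimplex 0 d)
      ≤ volume (edgeMap c '' P) * volume (rogersSimplex 0 d) := by gcongr
    _ = (ENNReal.ofReal |LinearMap.det (edgeMap c)| * volume P) *
          (ENNReal.ofReal |LinearMap.det (edgeMap d)| * volume paramSimplex) := by
        rw [Measure.addHaar_image_linearMap, volume_rogersSimplex_eq_det]
    _ = (ENNReal.ofReal |LinearMap.det (edgeMap d)| * volume P) *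
          (ENNReal.ofReal |LinearMap.det (edgeMap c)| * volume paramSimplex) := by ring
    _ = volume (ball (0 : E3) 1 ∩ rogersSimplex 0 d) * volume (rogersSimplex 0 c) := by
        rw [h2, Measure.addHaar_image_linearMap, volume_rogersSimplex_eq_det]

/-! ### Part 3. Rogers's Gram conditions and the canonical orthoscheme -/

/-- Rogers's constants `2i/(i+1)`, `i = 1, 2, 3` (indexed by `Fin 3`: `1, 4/3, 3/2`): the squared
distance from a centre to the plane of a facet, to the line of an edge, to a vertex of its Voronoi
cell is at least `2i/(i+1)` (Blichfeldt's inequality). [cite: Rogers1964, Ch. 7 §3, Lemma 1] -/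
def rogersGramConst (i : Fin 3) : ℝ := ![1, 4 / 3, 3 / 2] i

/-- **Rogers's Gram conditions** on the edge vectors `cᵢ − c₀` of a simplex `c₀ c₁ c₂ c₃` of his
dissection (origin at the centre `c₀`): `cᵢ · cⱼ ≥ 2i/(i+1)` for `1 ≤ i ≤ j ≤ 3`.
[cite: Rogers1964, Ch. 7 §3, Lemma 2] -/
def IsRogersGram (c : Fin 3 → E3) : Prop := ∀ i j : Fin 3, i ≤ j → rogersGramConst i ≤ ⟪c i, c j⟫

/-- **The canonical orthoscheme edge vectors** `g₁ = (1, 0, 0)`, `g₂ = (1, 1/√3, 0)`,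
`g₃ = (1, 1/√3, 1/√6)`: `gᵢ · gⱼ = 2i/(i+1)` for `i ≤ j`, so `T_g = L_g(Δ₃)` is congruent to each of
the `24` orthoschemes of the barycentric subdivision of the regular tetrahedron of side `2` (apex
a vertex, then the midpoint of an edge at distance `1`, the centroid of a face at distance `2/√3`,
the centroid of the tetrahedron at distance `√(3/2)`). [cite: Rogers1964, Ch. 7 §4 (the simplex
`G = g₀ g₁ … gₙ`)] -/
def rogersOrthoscheme : Fin 3 → E3 := ![!₂[1, 0, 0], !₂[1, 1 / √3, 0], !₂[1, 1 / √3, 1 / √6]]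

/-- The Gram matrix of the canonical orthoscheme: `gᵢ · gⱼ = 2 min(i,j)/(min(i,j)+1)`
("it is easy to verify that, if `1 ≤ i ≤ j ≤ n`, `(gᵢ − g₀)·(gⱼ − g₀) = 2i/(i+1)`").
[cite: Rogers1964, Ch. 7 §4] -/
theorem inner_rogersOrthoscheme (i j : Fin 3) :
    ⟪rogersOrthoscheme i, rogersOrthoscheme j⟫ = rogersGramConst (min i j) := by
  have h3 : (√3)⁻¹ * (√3)⁻¹ = 1 / 3 := by
    rw [← mul_inv, Real.mul_self_sqrt (by norm_num)]; norm_num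
  have h6 : (√6)⁻¹ * (√6)⁻¹ = 1 / 6 := by
    rw [← mul_inv, Real.mul_self_sqrt (by norm_num)]; norm_num
  rw [EuclideanSpace.inner_eq_star_dotProduct]
  fin_cases i <;> fin_cases j <;>
    simp [rogersOrthoscheme, rogersGramConst, dotProduct, Fin.sum_univ_three] <;> nlinarith [h3, h6]

/-- A simplex satisfying Rogers's Gram conditions dominates the canonical orthoscheme
entrywise. [cite: Rogers1964, Ch. 7 §4 ("Hence, by Lemma 2 of §3, cᵢ·cⱼ ≥ (gᵢ − g₀)·(gⱼ − g₀)")] -/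
theorem IsRogersGram.inner_orthoscheme_le {c : Fin 3 → E3} (hc : IsRogersGram c) (i j : Fin 3) :
    ⟪rogersOrthoscheme i, rogersOrthoscheme j⟫ ≤ ⟪c i, c j⟫ := by
  rw [inner_rogersOrthoscheme]
  rcases le_total i j with hij | hji
  · rw [min_eq_left hij]; exact hc i j hij
  · rw [min_eq_right hji, real_inner_comm]; exact hc j i hji


/-! ### Part 4. The two constants and the simplex bound -/

/-- `vol Δ₃ = 1/6` (in `E3`). [folklore] -/
theorem volume_paramSimplex : volume paramSimplex = ENNReal.ofReal (1 / 6) := by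
  have h : paramSimplex = WithLp.ofLp ⁻¹' cornerSimplex 3 1 := by
    ext t; simp [paramSimplex, cornerSimplex]
  rw [h, (PiLp.volume_preserving_ofLp (Fin 3)).measure_preimage
    (measurableSet_cornerSimplex 3 1).nullMeasurableSet, volume_cornerSimplex 3 zero_le_one]
  norm_num [Nat.factorial]

/-- `det L_c` is the determinant of the matrix with columns `c₁, c₂, c₃`. [folklore] -/
theorem det_edgeMap (c : Fin 3 → E3) :
    LinearMap.det (edgeMap c) = Matrix.det (Matrix.of fun i j => c j i) := by
  rw [← LinearMap.det_toMatrix (EuclideanSpace.basisFun (Fin 3) ℝ).toBasis]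
  congr 1
  ext i j
  rw [LinearMap.toMatrix_apply, OrthonormalBasis.coe_toBasis, OrthonormalBasis.coe_toBasis_repr_apply,
    EuclideanSpace.basisFun_repr, edgeMap_apply]
  simp [EuclideanSpace.basisFun_apply]

/-- `det L_g = 1 · (1/√3) · (1/√6)` (upper triangular). [folklore] -/
theorem det_edgeMap_orthoscheme : LinearMap.det (edgeMap rogersOrthoscheme) = (√3)⁻¹ * (√6)⁻¹ := by
  rw [det_edgeMap, Matrix.det_fin_three]
  simp [rogersOrthoscheme]

/-- `|det L_g| = 1/√18 = √2/6`. [folklore] -/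
theorem abs_det_edgeMap_orthoscheme : |LinearMap.det (edgeMap rogersOrthoscheme)| = √2 / 6 := by
  rw [det_edgeMap_orthoscheme, abs_of_pos (by positivity), ← mul_inv,
    ← Real.sqrt_mul (by norm_num), show (3 : ℝ) * 6 = 3 ^ 2 * 2 by norm_num,
    Real.sqrt_mul (by norm_num), Real.sqrt_sq (by norm_num)]
  have h2 : √2 * √2 = 2 := Real.mul_self_sqrt (by norm_num)
  have h2' : 0 < √2 := by positivity
  field_simp
  linarith

/-- **The volume of the canonical orthoscheme**:
`vol T_g = |det(g₁, g₂, g₃)|/3! = (1 · (1/√3) · (1/√6))/6 = 1/(18√2) = √2/36 ≈ 0.03928` (a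
`1/24` of the volume `2√2/3` of the regular tetrahedron of side `2`). [folklore]
[cite: HalesDSP2012, §1.2 ("the volume of a regular tetrahedron of side 2 is … 2√2/3")] -/
theorem volume_rogersOrthoscheme :
    volume (rogersSimplex 0 rogersOrthoscheme) = ENNReal.ofReal (√2 / 36) := by
  have : rogersSimplex 0 rogersOrthoscheme = edgeMap rogersOrthoscheme '' paramSimplex := by
    simp [rogersSimplex]
  rw [this, Measure.addHaar_image_linearMap, abs_det_edgeMap_orthoscheme,
    volume_paramSimplex, ← ENNReal.ofReal_mul (by positivity)]
  congr 1; ring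

/-- NAMED FACT — **the unit ball at the apex covers volume `(3θ − π)/18` of the canonical
orthoscheme**, `θ = arccos (1/3)`: `B(0,1) ∩ T_g` is the sector of the unit ball over a sixth of
the vertex cone of the regular tetrahedron, whose solid angle is `3θ − π` by Girard's formula
(Rogers: "`μ(S ∩ G)/μ(G) = σₙ`", with `σ₃ = √18 (cos⁻¹(1/3) − π/3)`). [cite: Rogers1964, Ch. 7 §4
and Introduction §3 (display after (19))] [cite: HalesDSP2012, §6.2 (p. 150)] -/
def Rogers1964_orthoschemeSectorVolume : Prop :=
  volume (ball (0 : E3) 1 ∩ rogersSimplex 0 rogersOrthoscheme) =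
    ENNReal.ofReal ((3 * tetDihedralAngle - π) / 18)

/-- `0 < 3θ − π` (the solid angle of the regular tetrahedron at a vertex is positive). [folklore] -/
theorem regTetSolidAngle_pos : 0 < 3 * tetDihedralAngle - π := by
  have := pi_div_three_lt; linarith

/-- `0 < σ₃`. [folklore] -/
theorem rogersBound_pos : 0 < rogersBound := by
  have := rogersBound_bounds.1; linarith

/-- The two constants give the density `σ₃ = vol(B ∩ T_g)/vol(T_g) = √2 (3θ − π)` of the
canonical orthoscheme (`((3θ − π)/18)/(√2/36) = √2 (3θ − π)`). [cite: Rogers1964, Ch. 7 §4 ("μ(S ∩ G)/μ(G) = σₙ")] -/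
theorem volume_ball_inter_orthoscheme (h2 : Rogers1964_orthoschemeSectorVolume) :
    volume (ball (0 : E3) 1 ∩ rogersSimplex 0 rogersOrthoscheme) =
      ENNReal.ofReal rogersBound * volume (rogersSimplex 0 rogersOrthoscheme) := by
  rw [h2, volume_rogersOrthoscheme, ← ENNReal.ofReal_mul rogersBound_pos.le, rogersBound_eq]
  congr 1
  have hs : √2 * √2 = 2 := Real.mul_self_sqrt (by norm_num)
  linear_combination (-(3 * tetDihedralAngle - π) / 36) * hs

/-- **Rogers's simplex bound**: a simplex with apex `v` whose edge vectors satisfy Rogers's Gram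
conditions has at most the fraction `σ₃` of its volume inside the unit ball at `v`
(monotonicity lemma + the two constants). [cite: Rogers1964, Ch. 7 §4 (proof of Theorem 7.1)] -/
theorem volume_ball_inter_le_of_isRogersGram (h2 : Rogers1964_orthoschemeSectorVolume)
    {c : Fin 3 → E3} (hc : IsRogersGram c) (v : E3) :
    volume (ball v 1 ∩ rogersSimplex v c) ≤
      ENNReal.ofReal rogersBound * volume (rogersSimplex v c) := by
  rw [volume_ball_inter_rogersSimplex, volume_rogersSimplex v]
  have hmono := volume_ball_inter_mul_le_of_gram_le (c := c) (d := rogersOrthoscheme)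
    fun i j => hc.inner_orthoscheme_le i j
  rw [volume_ball_inter_orthoscheme h2, mul_right_comm] at hmono
  have hpos : volume (rogersSimplex 0 rogersOrthoscheme) ≠ 0 := by
    rw [volume_rogersOrthoscheme]; exact (ENNReal.ofReal_pos.2 (by positivity)).ne'
  exact (ENNReal.mul_le_mul_iff_left hpos (volume_rogersSimplex_lt_top _ _).ne).1 hmono

/-! ### Part 5. Rogers's dissection (named fact) and the Voronoi-cell bound -/

/-- NAMED FACT — **Rogers's dissection of a Voronoi cell.** For a saturated packing `V` of unit
balls and `v ∈ V`, the Voronoi cell `Ω(V, v)` is, up to a null set, the union of finitely many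
simplices `v + L_c(Δ₃)` contained in `Ω(V, v)`, pairwise intersecting in null sets, whose edge
vectors satisfy Rogers's Gram conditions `cᵢ · cⱼ ≥ 2i/(i+1)` (`1 ≤ i ≤ j ≤ 3`): Rogers's
simplices `c₀ c₁ c₂ c₃`, `c₀ = v`, `cⱼ` the point nearest to `v` of a `(3 − j)`-face of `Ω(V, v)`
containing `c_{j+1}, …`, which "fit together, without overlapping … and without gaps", with the
Gram bounds from Blichfeldt's inequality. [cite: Rogers1964, Ch. 7 §2 (dissection) and §3,
Lemmas 1–2] [cite: HalesDSP2012, Lemma 6.26 (Rogers decomposition) and Lemma 6.29 (Rogers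
disjoint)] -/
def Rogers1964_dissection : Prop :=
  ∀ V : Set (EuclideanSpace ℝ (Fin 3)), IsUnitBallPacking V → IsSaturated V → ∀ v ∈ V,
    ∃ s : Finset (Fin 3 → EuclideanSpace ℝ (Fin 3)),
      (∀ c ∈ s, IsRogersGram c ∧ rogersSimplex v c ⊆ voronoiCell V v) ∧
      (s : Set (Fin 3 → EuclideanSpace ℝ (Fin 3))).Pairwise
        (Function.onFun (AEDisjoint volume) fun c => rogersSimplex v c) ∧
      volume (voronoiCell V v \ ⋃ c ∈ s, rogersSimplex v c) = 0

/-- NAMED FACT — **Rogers's bound, Voronoi-cell form**: in a saturated packing of unit balls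
every Voronoi cell has volume at least `(4π/3)/σ₃`, i.e. `vol B(v, 1) ≤ σ₃ · vol Ω(V, v)`
(sum of the simplex bounds over Rogers's dissection of the cell; Rogers's equations (9)–(10)).
[cite: Rogers1964, Ch. 7 §4 (proof of Theorem 7.1)] -/
def Rogers1964_cellBound : Prop :=
  ∀ V : Set (EuclideanSpace ℝ (Fin 3)), IsUnitBallPacking V → IsSaturated V → ∀ v ∈ V,
    volume (ball v 1) ≤ ENNReal.ofReal rogersBound * volume (voronoiCell V v)

/-- **Dissection + simplex bound ⇒ cell bound.** [cite: Rogers1964, Ch. 7 §4] -/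
theorem cellBound_of_dissection (hD : Rogers1964_dissection)
    (h2 : Rogers1964_orthoschemeSectorVolume) : Rogers1964_cellBound := by
  intro V hV hsat v hv
  obtain ⟨s, hs, hdisj, hnull⟩ := hD V hV hsat v hv
  set U := ⋃ c ∈ s, rogersSimplex v c with hUdef
  have hU : volume U = ∑ c ∈ s, volume (rogersSimplex v c) :=
    measure_biUnion_finset₀ hdisj fun c _ => (measurableSet_rogersSimplex v c).nullMeasurableSet
  have hUΩ : U ⊆ voronoiCell V v := Set.iUnion₂_subset fun c hc => (hs c hc).2
  calc volume (ball v 1) = volume (ball v 1 ∩ voronoiCell V v) := by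
        rw [Set.inter_eq_left.2 (ball_subset_voronoiCell hV hv)]
    _ ≤ volume (ball v 1 ∩ U ∪ voronoiCell V v \ U) := by
        refine measure_mono ?_
        rintro p ⟨hpb, hpΩ⟩
        by_cases hpU : p ∈ U
        · exact Or.inl ⟨hpb, hpU⟩
        · exact Or.inr ⟨hpΩ, hpU⟩
    _ ≤ volume (ball v 1 ∩ U) + volume (voronoiCell V v \ U) := measure_union_le _ _
    _ = volume (⋃ c ∈ s, (ball v 1 ∩ rogersSimplex v c)) := by
        rw [hnull, add_zero, hUdef, Set.inter_iUnion₂]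
    _ ≤ ∑ c ∈ s, volume (ball v 1 ∩ rogersSimplex v c) := measure_biUnion_finset_le s _
    _ ≤ ∑ c ∈ s, ENNReal.ofReal rogersBound * volume (rogersSimplex v c) :=
        Finset.sum_le_sum fun c hc => volume_ball_inter_le_of_isRogersGram h2 (hs c hc).1 v
    _ = ENNReal.ofReal rogersBound * volume U := by rw [hU, Finset.mul_sum]
    _ ≤ ENNReal.ofReal rogersBound * volume (voronoiCell V v) := by gcongr

/-! ### Part 6. From the cell bound to Rogers's density bound -/

/-- **Boundary-layer estimate**: for a saturated packing, `δ(V, 0, r) ≤ σ₃ (1 + 3/r)³` for all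
`r > 0` (the cells of the centres in `B(0, r+1)` are a.e. disjoint and lie in `B(0, r+3)`).
[cite: HalesDSP2012, Lemma 6.13 (proof)] [cite: Rogers1964, Ch. 7 §4] -/
theorem finiteDensity_le_of_cellBound (hcell : Rogers1964_cellBound) {V : Set E3}
    (hV : IsUnitBallPacking V) (hsat : IsSaturated V) {r : ℝ} (hr : 0 < r) :
    finiteDensity V 0 r ≤ ENNReal.ofReal (rogersBound * (1 + 3 / r) ^ 3) := by
  have hfin := finite_inter_ball_of_packing hV 0 (r + 1)
  have hmemF : ∀ v, v ∈ hfin.toFinset ↔ v ∈ V ∧ dist v 0 < r + 1 := fun v => by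
    rw [Set.Finite.mem_toFinset]; rfl
  have hnum : volume (ball (0 : E3) r ∩ ⋃ v ∈ V, ball v 1) ≤
      ENNReal.ofReal rogersBound * volume (ball (0 : E3) (r + 3)) := by
    calc volume (ball (0 : E3) r ∩ ⋃ v ∈ V, ball v 1)
        ≤ volume (⋃ v ∈ hfin.toFinset, ball v 1) := by
          refine measure_mono ?_
          rintro p ⟨hp0, hpU⟩
          obtain ⟨v, hv, hpv⟩ := Set.mem_iUnion₂.1 hpU
          refine Set.mem_iUnion₂.2 ⟨v, (hmemF v).2 ⟨hv, ?_⟩, hpv⟩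
          rw [mem_ball] at hp0 hpv
          calc dist v 0 ≤ dist p v + dist p 0 := by rw [dist_comm p v]; exact dist_triangle v p 0
            _ < 1 + r := add_lt_add hpv hp0
            _ = r + 1 := add_comm _ _
      _ ≤ ∑ v ∈ hfin.toFinset, volume (ball v 1) := measure_biUnion_finset_le _ _
      _ ≤ ∑ v ∈ hfin.toFinset, ENNReal.ofReal rogersBound * volume (voronoiCell V v) :=
          Finset.sum_le_sum fun v hv => hcell V hV hsat v ((hmemF v).1 hv).1
      _ = ENNReal.ofReal rogersBound * volume (⋃ v ∈ hfin.toFinset, voronoiCell V v) := by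
          rw [← Finset.mul_sum, measure_biUnion_finset₀]
          · intro v hv w hw hvw
            exact volume_voronoiCell_inter ((hmemF v).1 hv).1 ((hmemF w).1 hw).1 hvw
          · exact fun v _ => (measurableSet_voronoiCell V v).nullMeasurableSet
      _ ≤ ENNReal.ofReal rogersBound * volume (ball (0 : E3) (r + 3)) := by
          gcongr
          refine Set.iUnion₂_subset fun v hv p hp => ?_
          have hv' := ((hmemF v).1 hv).2
          have hp' := voronoiCell_subset_ball hsat v hp
          rw [mem_ball] at hp' ⊢
          calc dist p 0 ≤ dist p v + dist v 0 := dist_triangle p v 0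
            _ < 2 + (r + 1) := add_lt_add hp' hv'
            _ = r + 3 := by ring
  unfold finiteDensity
  calc volume (ball (0 : E3) r ∩ ⋃ v ∈ V, ball v 1) / volume (ball (0 : E3) r)
      ≤ ENNReal.ofReal rogersBound * volume (ball (0 : E3) (r + 3)) / volume (ball (0 : E3) r) := by
        gcongr
    _ = ENNReal.ofReal (rogersBound * (1 + 3 / r) ^ 3) := by
        have h3 : (0 : ℝ) ≤ (r + 3) ^ 3 := by positivity
        have h3' : (0 : ℝ) ≤ r ^ 3 := by positivity
        have hden : (0 : ℝ) < r ^ 3 * (π * 4 / 3) := by positivity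
        rw [EuclideanSpace.volume_ball_fin_three, EuclideanSpace.volume_ball_fin_three,
          ← ENNReal.ofReal_pow (by linarith), ← ENNReal.ofReal_pow hr.le,
          ← ENNReal.ofReal_mul h3, ← ENNReal.ofReal_mul h3',
          ← ENNReal.ofReal_mul rogersBound_pos.le, ← ENNReal.ofReal_div_of_pos hden]
        congr 1
        field_simp

/-- **Cell bound ⇒ Rogers's bound** (`Rogers1958_bound`, density read as
`limsup_r δ(V, 0, r)`): extend `V` to a saturated packing (the density only grows), apply the
boundary-layer estimate and let `r → ∞`. [cite: Rogers1964, Ch. 7 §4, Theorem 7.1]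
[cite: HalesDSP2012, §6.2 (p. 150) and Remark 6.16] -/
theorem Rogers1958_bound_of_cellBound (hcell : Rogers1964_cellBound) : Rogers1958_bound := by
  intro V hV
  obtain ⟨W, hVW, hW, hWsat⟩ := IsUnitBallPacking.exists_saturated_superset hV
  have hg : Tendsto (fun r : ℝ => ENNReal.ofReal (rogersBound * (1 + 3 / r) ^ 3)) atTop
      (𝓝 (ENNReal.ofReal rogersBound)) := by
    apply ENNReal.tendsto_ofReal
    have h3 : Tendsto (fun r : ℝ => 3 / r) atTop (𝓝 0) := tendsto_const_nhds.div_atTop tendsto_id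
    have := ((tendsto_const_nhds (x := (1 : ℝ))).add h3).pow 3 |>.const_mul rogersBound
    simpa using this
  calc limsup (fun r => finiteDensity V 0 r) atTop
      ≤ limsup (fun r : ℝ => ENNReal.ofReal (rogersBound * (1 + 3 / r) ^ 3)) atTop := by
        refine Filter.limsup_le_limsup ?_
        filter_upwards [eventually_gt_atTop 0] with r hr
        exact (finiteDensity_mono hVW 0 r).trans (finiteDensity_le_of_cellBound hcell hW hWsat hr)
    _ = ENNReal.ofReal rogersBound := hg.limsup_eq

/-- **The whole reduction**: Rogers's dissection and the two orthoscheme constants imply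
`Rogers1958_bound`. [cite: Rogers1964, Ch. 7, Theorem 7.1] -/
theorem Rogers1958_bound_of_parts (hD : Rogers1964_dissection)
    (h2 : Rogers1964_orthoschemeSectorVolume) : Rogers1958_bound :=
  Rogers1958_bound_of_cellBound (cellBound_of_dissection hD h2)

end Literature.Barriers.AtomisticToContinuum

end
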